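import Mathlib
import HarnessLib
import Summits.Langlands.Langlands.Theses.SenNullAlignment
import Literature.NumberTheory.PAdicHodge.SenOperator
import Literature.NumberTheory.GaloisRepresentations.DecompositionGroupOfCompletion

/-!
# Birth skeleton (BC3) for crux stmt-Langlands-16358
`Summit.Langlands.Langlands.Theses.SenNullAlignment.SingularProjectiveFinite` — line `birth`

Route `route-Langlands-SenNullAlignment` (`closes : SingularProjectiveFinite → NonAlignedAtEll →
AlignedAtEll → AwayFromEll → OddNonRegularAttached → RegularServed → SectorComplement → Langlands`).
The crux (THE LEVER of the route): `K` totally real; `π` cuspidal on `GL₂(𝔸_K)`, L-algebraic,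
holomorphic of weight `(k, w)`, totally odd, with some `k_β = 1`; `ℓ`, `ι`; `ρ : Γ_K → GL₂(ℚ̄_ℓ)`
irreducible and Satake–Frobenius compatible with `π` at almost all `v`.  Then at every `v ∣ ℓ`
that is FULLY ALIGNED (every `ℓ`-adic embedding `τ : K → ℚ̄_ℓ` inducing `v` reads weight one,
`k(ι ∘ τ) = 1`) the image under `ρ` of every inertia group `I_𝔓`, `𝔓 ∣ v`, is finite modulo
scalars.

The route's own intended proof (route header, RANKED CRUXES #2) is cut into its three printed
steps plus the vendoring debt they stand on, all typed over the Sen-operator carrier that the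
route's definition request D1 has since delivered (`Literature/NumberTheory/PAdicHodge/SenOperator`:
`FramedGaloisRep.senWeightsAt`, `FramedGaloisRep.IsHodgeTateAt`, the named facts
`SenOperatorExistsUnique` (Sen 1980) and `SenFiniteness` (Sen 1973)), for the canonical
`ℚ_ℓ`-structure `LocalField.adicCompletionPadicAlgebra v ℓ hv` of `K_v`:

* `stub_senWeightsCoincideAtAligned` (IN PRINT, unvendored; size L) — under the crux hypotheses,
  at a fully aligned `v ∣ ℓ` ALL `τ`-labelled Hodge–Tate–Sen weights of `ρ|_{Γ_{K_v}}` are one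
  and the same integer `m` (`∃ m : ℤ, ∀ τ, senWeightsAt ⊆ {m}`): the generalized Hodge–Tate
  weights of the congruence-built `ρ_{π,ι}` are `{(w ∓ (k_τ - 1))/2}` up to the sign convention
  (Boxer–Pilloni 2021 Thm 23 (3) = Thm 351 (3) of §6.11, arXiv:2110.10251 p. 10 / p. 121:
  generalized `ι⁻¹∘τ`-Hodge–Tate weights `(-λ_{2,τ} + 1/2, -λ_{1,τ} + 1/2)` of the weakly
  regular odd `π`, by Sen theory in the analytic family over the eigenvariety; Buzzard–Gee
  Rem. 3.2.3 recipe), so at `k_τ = 1` for every `τ ∣ v` they collapse to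
  the single value `±w/2 ∈ ℤ` (`w` is even as soon as some `k_β = 1`, by L-algebraicity).
  Stated `∃ m` (no sign convention is asserted).  Conditional on `SenOperatorExistsUnique`
  (the pinned `Θ` is Sen's operator).
* `stub_hodgeTateAtAligned` (THE OPEN HEART — Sen semisimplicity / Hodge–Tate-ness at the
  singular embeddings; size XL, open) — under the crux hypotheses, at a fully aligned `v ∣ ℓ`,
  `ρ|_{Γ_{K_v}}` is Hodge–Tate at EVERY `τ : K_v → ℚ̄_ℓ` (`Θ_τ` semisimple with integer
  eigenvalues, `FramedGaloisRep.IsHodgeTateAt`).  Intended: geometric Sen theory on the perfectoid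
  Hilbert modular variety (Pan II §§5–6 for modular curves; Rodríguez Camargo; Jiang 2026 for
  regular multiweights) reads `Θ_τ` off the classical coherent class of `π`; nothing in print gives
  it at a weight-one `τ`.  This is exactly the route's "why it might fail" (a classical partial
  weight one `π` whose `ρ` is `τ`-Hodge–Tate-defective at an aligned place refutes it).
* `stub_projectiveSenFiniteness` (Sen 1973 in projective form + the local/global inertia
  dictionary; size M, provable now from the two facts) — for ANY `ρ : Γ_K → GL₂(ℚ̄_ℓ)` and
  `v ∣ ℓ`: a single integer weight at every `τ` plus Hodge–Tate at every `τ` force the inertia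
  image at every `𝔓 ∣ v` to be finite modulo scalars.  Proof plan: `W_τ` is `Θ`-stable
  (`senEnd_mem_labelComponent`) so the integer eigen-decomposition of `x ∈ W_τ` stays in `W_τ`
  (Lagrange interpolation in `Θ`), whence `Θ = m` on each `W_τ`; `W = ⊕_τ W_τ` over the
  continuous `τ` (`CoeffEigen.iSup_eigenSub_eq_top`, `ℚ̄_ℓ` splits `K_v`), so `Θ = m · id`;
  twisting by `ε^{-m}` (or passing to `ad ρ`, on which `Θ` then vanishes) and `SenFiniteness` give
  a finite inertia image for the twist at `absInertia K_v`, i.e. `ρ(res I_{K_v}) ⊆ ε^m · (finite)`;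
  `I_{𝔓₀} = res(I_{K_v})` (`inertia_adicCompletionPrime_eq_map_absInertia`, Neukirch II.9.6) and
  all `𝔓 ∣ v` are `Γ_K`-conjugate to `𝔓₀` (Mathlib `Algebra.IsInvariant.exists_smul_of_under_eq`),
  conjugation preserving "finite modulo scalars".
* `stub_senTheory` (VENDORING DEBT, T0 literature facts; size XL as a formalisation, TRUE in print)
  — Sen's two theorems as typed in the tree: `SenOperatorExistsUnique ∧ SenFiniteness`
  (Brinon–Conrad Thm 15.1.2/15.1.5/15.1.7; Sen 1973 / Berger 2004 §1–2).  It is a stub only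
  because the crux is typed ABSOLUTELY (no fact antecedent): the honest alternative is for the
  tenure planner to re-file the crux as `SenOperatorExistsUnique → SenFiniteness → …`, which
  deletes this stub and nothing else.

`SingularProjectiveFinite_of` is pure logic: feed the facts of `stub_senTheory` to the other
three and compose.  Read-back `crux_iff : SingularProjectiveFinite ↔ UnderCruxHypotheses (…
ProjFiniteInertiaAt …) := Iff.rfl` certifies that the telescope used by the stubs is the crux's,
verbatim.  No stub alone gives the crux or the summit (BC3 probes `bc/probe_*.lean`, 8/8 FAIL).

Disproof used: none exists for this crux (`ledger crux ls stmt-Langlands-16358`: no workfiles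
before this one); the negatives index of the summit (SplitPrimeInductionDeinduction,
OrdinaryPrimeTransportRankinSelbergPoleCount, K3KugaSatakeDescentSerreTypeAnchor) is not touched
(no Sen / Hodge–Tate statement among them).
-/

noncomputable section

set_option linter.dupNamespace false

namespace Summit.Langlands.Langlands.Cruxes.SingularProjectiveFinite.Birth

open scoped BigOperators Topology Classical Matrix NumberField
open Filter Set Function IsDedekindDomain NumberField Field
open Literature.NumberTheory.GaloisRepresentations Literature.NumberTheory.Automorphic
open Literature.NumberTheory.PAdicHodge (SenOperatorExistsUnique SenFiniteness)
open Summit.Langlands.Langlands.Theses.SenNullAlignment (SingularProjectiveFinite)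

/-! ## The three Galois-side interfaces at a place `v ∣ ℓ` -/

section Interfaces

variable {K : Type} [Field K] [NumberField K] {ℓ : ℕ} [Fact ℓ.Prime]

/-- **Single Sen weight at `v`**: for the canonical `ℚ_ℓ`-structure of `K_v`, all `τ`-labelled
Hodge–Tate–Sen weights of `ρ|_{Γ_{K_v}}` (eigenvalues of Sen's operator `Θ` on the `τ`-component
`W_τ` of `ℚ̄_ℓ² ⊗_{ℚ_ℓ} ℂ_{K_v}`), for every `τ : K_v →+* ℚ̄_ℓ`, lie in `{m}` for ONE integer `m`. -/
def SenSingleWeightAt (ρ : FramedGaloisRep K (PadicAlgCl ℓ) 2) (v : HeightOneSpectrum (𝓞 K))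
    (hv : ((ℓ : ℕ) : 𝓞 K) ∈ v.asIdeal) : Prop :=
  ∃ m : ℤ, ∀ τ : v.adicCompletion K →+* PadicAlgCl ℓ,
    ρ.senWeightsAt v (LocalField.adicCompletionPadicAlgebra v ℓ hv) τ ⊆ {(m : PadicAlgCl ℓ)}

/-- **Hodge–Tate at the place `v`**: `ρ|_{Γ_{K_v}}` is Hodge–Tate at every `τ : K_v →+* ℚ̄_ℓ`
(`Θ_τ` semisimple with integer eigenvalues), for the canonical `ℚ_ℓ`-structure of `K_v`. -/
def HodgeTateAtPlace (ρ : FramedGaloisRep K (PadicAlgCl ℓ) 2) (v : HeightOneSpectrum (𝓞 K))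
    (hv : ((ℓ : ℕ) : 𝓞 K) ∈ v.asIdeal) : Prop :=
  ∀ τ : v.adicCompletion K →+* PadicAlgCl ℓ,
    ρ.IsHodgeTateAt v (LocalField.adicCompletionPadicAlgebra v ℓ hv) τ

/-- **Inertia finite modulo scalars above `v`** — the crux's conclusion, VERBATIM: for every prime
`𝔓` of `\bar ℤ_K` above `v` there is a finite set `S ⊆ GL₂(ℚ̄_ℓ)` such that every `ρ(σ)`,
`σ ∈ I_𝔓`, is a scalar multiple of a member of `S`. -/
def ProjFiniteInertiaAt (ρ : FramedGaloisRep K (PadicAlgCl ℓ) 2) (v : HeightOneSpectrum (𝓞 K)) :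
    Prop :=
  ∀ 𝔓 ∈ v.primesAbove, ∃ S : Finset (GL (Fin 2) (PadicAlgCl ℓ)), ∀ σ ∈ 𝔓.inertia (Field.absoluteGaloisGroup K), ∃ g ∈ S, ∃ c : PadicAlgCl ℓ, ((ρ σ : GL (Fin 2) (PadicAlgCl ℓ)) : Matrix (Fin 2) (Fin 2) (PadicAlgCl ℓ)) = c • ((g : GL (Fin 2) (PadicAlgCl ℓ)) : Matrix (Fin 2) (Fin 2) (PadicAlgCl ℓ))

end Interfaces

/-! ## The crux's binder telescope with a variable conclusion -/

/-- `UnderCruxHypotheses C`: the crux `SingularProjectiveFinite` with its conclusion replaced by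
`C K ℓ ρ v hv` — VERBATIM telescope: `K` totally real; `π` cuspidal on `GL₂(𝔸_K)`, L-algebraic,
holomorphic of weight `(k, w)` (inlined infinity type), totally odd, some `k_β = 1`; `ℓ`, `ι`,
`ρ` irreducible and Satake–Frobenius compatible a.e.; `v ∣ ℓ` fully aligned. -/
def UnderCruxHypotheses
    (C : ∀ (K : Type) [Field K] [NumberField K] (ℓ : ℕ) [Fact ℓ.Prime],
      Literature.NumberTheory.GaloisRepresentations.FramedGaloisRep K (PadicAlgCl ℓ) 2 →
        ∀ v : IsDedekindDomain.HeightOneSpectrum (NumberField.RingOfIntegers K),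
          ((ℓ : ℕ) : NumberField.RingOfIntegers K) ∈ v.asIdeal → Prop) : Prop :=
  ∀ (K : Type) [Field K] [NumberField K], NumberField.IsTotallyReal K → ∀ (hcpt : Literature.NumberTheory.Automorphic.isCompact_glFiniteIntegralLevel 2 K) (π : Literature.NumberTheory.Automorphic.CuspidalAutomorphicRepData 2 K hcpt) (k : (K →+* ℂ) → ℕ) (w : ℤ), π.1.IsLAlgebraic → π.1.HasInfinityType (fun β : K →+* ℂ => ({(⟨((k β : ℂ) - 1 - w) / 2, (1 - (k β : ℂ) - w) / 2, (k β : ℤ) - 1, by push_cast; ring⟩ : Literature.NumberTheory.Automorphic.ArchWeight), (⟨((k β : ℂ) - 1 - w) / 2, (1 - (k β : ℂ) - w) / 2, (k β : ℤ) - 1, by push_cast; ring⟩ : Literature.NumberTheory.Automorphic.ArchWeight).swap} : Multiset Literature.NumberTheory.Automorphic.ArchWeight)) → (∀ (u : NumberField.InfinitePlace K), ∀ φ ∈ π.1.W, Literature.NumberTheory.Automorphic.rightTranslation (Literature.NumberTheory.Automorphic.AdelicGroupData.gl 2 K) (Matrix.GeneralLinearGroup.scalar (Fin 2) (Units.map (MonoidHom.inl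 (NumberField.InfiniteAdeleRing K) (IsDedekindDomain.FiniteAdeleRing (NumberField.RingOfIntegers K) K) : NumberField.InfiniteAdeleRing K →* NumberField.AdeleRing (NumberField.RingOfIntegers K) K) (Units.map (MonoidHom.mulSingle (fun u' : NumberField.InfinitePlace K => u'.Completion) u : u.Completion →* NumberField.InfiniteAdeleRing K) (-1)))) φ + φ ∈ π.1.W') → (∃ β : K →+* ℂ, k β = 1) → ∀ (ℓ : ℕ) [Fact ℓ.Prime] (ι : PadicAlgCl ℓ ≃+* ℂ) (ρ : Literature.NumberTheory.GaloisRepresentations.FramedGaloisRep K (PadicAlgCl ℓ) 2), ρ.toGaloisRep.IsIrreducible → (∀ᶠ v : IsDedekindDomain.HeightOneSpectrum (NumberField.RingOfIntegers K) in Filter.cofinite, Summit.Langlands.SatakeFrobCompatibleAt ι π.1 ρ v) → ∀ (v : IsDedekindDomain.HeightOneSpectrum (NumberField.RingOfIntegers K)) (hv : ((ℓ : ℕ) : NumberField.RingOfIntegers K) ∈ v.asIdeal), (∀ τ : K →+* PadicAlgCl ℓ, (∀ x : NumberField.RingOfIntegers K, x ∈ v.asIdeal → ‖τ x‖ < 1)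 → k ((ι : PadicAlgCl ℓ →+* ℂ).comp τ) = 1) → C K ℓ ρ v hv

/-- Read-back: the crux is LITERALLY the telescope with conclusion `ProjFiniteInertiaAt ρ v`. -/
theorem crux_iff :
    SingularProjectiveFinite ↔ UnderCruxHypotheses fun _ _ _ _ _ ρ v _ => ProjFiniteInertiaAt ρ v :=
  Iff.rfl

/-! ## The four stubs -/

/-- **Stub 1 (Sen weights coincide at aligned places; IN PRINT, unvendored; size L).**  Under the
crux hypotheses, at a fully aligned `v ∣ ℓ` all `τ`-labelled Hodge–Tate–Sen weights of
`ρ|_{Γ_{K_v}}` are a single integer `m` (`= ±w/2`): generalized Hodge–Tate weights of `ρ_{π,ι}`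
(Boxer–Pilloni 2021 Thm 23 (3) = Thm 351 (3), arXiv:2110.10251 p. 10/121, for the weakly
regular odd `π` — partial weight one IS weakly regular; Buzzard–Gee Rem. 3.2.3) collapse at `k_τ = 1`;
`ρ ≃ ρ_{π,ι}` by Chebotarev + Brauer–Nesbitt (irreducible, Satake-compatible a.e.).  Conditional
on Sen's existence theorem (the pinned `Θ` IS Sen's operator).  Why it might fail: only a
normalisation slip (`ι`, arithmetic Frobenius, `|det|` twists) — the `∃ m` form asserts no sign.
Sources: BoxerPilloni2021HigherColeman Thm 23 (3); BuzzardGeeLMS2014 Rem. 3.2.3; Jarvis1997. -/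
theorem stub_senWeightsCoincideAtAligned : SenOperatorExistsUnique →
    UnderCruxHypotheses fun _ _ _ _ _ ρ v hv => SenSingleWeightAt ρ v hv := by
  sorry

/-- **Stub 2 (Hodge–Tate at the singular embeddings of an aligned place; THE OPEN HEART; size XL).**
Under the crux hypotheses, at a fully aligned `v ∣ ℓ`, `ρ|_{Γ_{K_v}}` is Hodge–Tate at every
`τ : K_v →+* ℚ̄_ℓ` (Sen's operator is semisimple with integer eigenvalues on each `W_τ`).
Intended: `τ`-Hodge–Tate NULLITY of the classical eigensystem via geometric Sen theory on the
perfectoid Hilbert modular variety (Pan II §§5–6, Rodríguez Camargo 2022, Jiang 2026), run in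
direction (A).  Why it might fail: a classical partial-weight-one `π` whose `ρ` is
`τ`-Hodge–Tate-defective (non-semisimple `Θ_τ`) at an aligned place — nothing in print forbids it.
Sources: PanLocallyAnalyticII2022 §§5–6; RodriguezCamargo2022GeometricSen; Jiang2026ClassicalityHilbert;
Ding2014PartiallyDeRham; arXiv:2603.27937. -/
theorem stub_hodgeTateAtAligned : SenOperatorExistsUnique →
    UnderCruxHypotheses fun _ _ _ _ _ ρ v hv => HodgeTateAtPlace ρ v hv := by
  sorry

/-- **Stub 3 (projective Sen finiteness + the inertia dictionary; size M, provable from the facts).**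
For ANY `ρ : Γ_K → GL₂(ℚ̄_ℓ)` and `v ∣ ℓ`: one integer weight at every `τ` and Hodge–Tate at every
`τ` force `Θ = m · id` on `W = ⊕_τ W_τ`, hence (twist by `ε^{-m}` / pass to `ad ρ`, then
`SenFiniteness`) a finite inertia image up to scalars at `absInertia K_v`, transported to every
`I_𝔓`, `𝔓 ∣ v`, by `inertia_adicCompletionPrime_eq_map_absInertia` (Neukirch II.9.6) and the
`Γ_K`-conjugacy of the primes above `v`.  Why it might fail: only through the carrier (wild,
non-`ℚ_ℓ`-linear `τ` have `W_τ = 0`; the `Γ_K`-equivariance of the pinned `Θ` under twist must be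
derived from `IsSenOperator` + uniqueness).  Sources: Sen1973; BrinonConrad2009 Cor. 15.1.10,
Ex. 15.5.4; BergerLaurent2004Introduction §1–2; NeukirchANT1999 II (9.6). -/
theorem stub_projectiveSenFiniteness : SenOperatorExistsUnique → SenFiniteness →
    ∀ (K : Type) [Field K] [NumberField K] (ℓ : ℕ) [Fact ℓ.Prime]
      (ρ : FramedGaloisRep K (PadicAlgCl ℓ) 2) (v : HeightOneSpectrum (𝓞 K))
      (hv : ((ℓ : ℕ) : 𝓞 K) ∈ v.asIdeal),
      SenSingleWeightAt ρ v hv → HodgeTateAtPlace ρ v hv → ProjFiniteInertiaAt ρ v := by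
  sorry

/-- **Stub 4 (Sen's theorems — VENDORING DEBT of the carrier; TRUE in print; size XL to formalise).**
Existence/uniqueness of Sen's operator and Sen's finiteness theorem, as the tree's named facts
(`PAdicHodge.SenOperatorExistsUnique`, `PAdicHodge.SenFiniteness`).  A stub only because the crux
is typed with no fact antecedent; re-filing the crux as `SenOperatorExistsUnique → SenFiniteness →
…` (tenure) deletes it.  Why it might fail: only a typing artefact of the two facts (reviewed and
accepted with the carrier).  Sources: Sen1980; Sen1973; BrinonConrad2009 Thm 15.1.2/15.1.5/15.1.7,
Thm 2.2.7; BergerLaurent2004Introduction §2. -/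
theorem stub_senTheory : SenOperatorExistsUnique ∧ SenFiniteness := by
  sorry

/-! ## Stub statements as named propositions (for the BC3 probes and the registrar) -/

namespace _Goal

/-- Statement of `stub_senWeightsCoincideAtAligned`. -/
def stub_senWeightsCoincideAtAligned : Prop :=
  SenOperatorExistsUnique → UnderCruxHypotheses fun _ _ _ _ _ ρ v hv => SenSingleWeightAt ρ v hv

/-- Statement of `stub_hodgeTateAtAligned`. -/
def stub_hodgeTateAtAligned : Prop :=
  SenOperatorExistsUnique → UnderCruxHypotheses fun _ _ _ _ _ ρ v hv => HodgeTateAtPlace ρ v hv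

/-- Statement of `stub_projectiveSenFiniteness`. -/
def stub_projectiveSenFiniteness : Prop :=
  SenOperatorExistsUnique → SenFiniteness →
    ∀ (K : Type) [Field K] [NumberField K] (ℓ : ℕ) [Fact ℓ.Prime]
      (ρ : FramedGaloisRep K (PadicAlgCl ℓ) 2) (v : HeightOneSpectrum (𝓞 K))
      (hv : ((ℓ : ℕ) : 𝓞 K) ∈ v.asIdeal),
      SenSingleWeightAt ρ v hv → HodgeTateAtPlace ρ v hv → ProjFiniteInertiaAt ρ v

/-- Statement of `stub_senTheory`. -/
def stub_senTheory : Prop :=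
  SenOperatorExistsUnique ∧ SenFiniteness

end _Goal

/-- The stubs prove their named statements (read-back). -/
theorem goals_hold :
    _Goal.stub_senWeightsCoincideAtAligned ∧ _Goal.stub_hodgeTateAtAligned ∧
      _Goal.stub_projectiveSenFiniteness ∧ _Goal.stub_senTheory :=
  ⟨stub_senWeightsCoincideAtAligned, stub_hodgeTateAtAligned, stub_projectiveSenFiniteness,
    stub_senTheory⟩

/-! ## The composition: the four stubs imply the crux BY NAME -/

/-- **BC3 composition.** `stub_senWeightsCoincideAtAligned → stub_hodgeTateAtAligned →
stub_projectiveSenFiniteness → stub_senTheory → SingularProjectiveFinite` (the route decl, by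
name): pure logic — Sen's facts feed the three Galois-side stubs, place by place. -/
theorem SingularProjectiveFinite_of (h₁ : _Goal.stub_senWeightsCoincideAtAligned)
    (h₂ : _Goal.stub_hodgeTateAtAligned) (h₃ : _Goal.stub_projectiveSenFiniteness)
    (h₄ : _Goal.stub_senTheory) : SingularProjectiveFinite := by
  intro K _ _ hK hcpt π k w hL hhol hodd hne ℓ _ ι ρ hirr hae v hv hal
  exact h₃ h₄.1 h₄.2 K ℓ ρ v hv
    (h₁ h₄.1 K hK hcpt π k w hL hhol hodd hne ℓ ι ρ hirr hae v hv hal)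
    (h₂ h₄.1 K hK hcpt π k w hL hhol hodd hne ℓ ι ρ hirr hae v hv hal)

end Summit.Langlands.Langlands.Cruxes.SingularProjectiveFinite.Birth

end
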